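import Summits.QuantumFields.YangMills.Theorems.PoincareLipschitzSobolevCellTiling
import Summits.QuantumFields.YangMills.Theorems.PoincareLipschitzSobolevBadCellCount
import Summits.QuantumFields.YangMills.Theorems.PoincareLipschitzBlowDownCells
import Summits.QuantumFields.YangMills.Theorems.PoincareLipschitzLatticeToContinuumSobolevLetters
import HarnessLib

/-!
# LINE 25 «CompactnessTransfer» (K2 crux `BlockLipschitzL` stmt-QuantumFields-23533 ∕ crux `HistoryTailL` stmt-QuantumFields-19936), S2♭″ brick (Γ5-D)
# «THE `L²` ROW» — LETTERS

Cell `ym3-torus` (YM ladder rung R3 = continuum SU(2) Yang–Mills on the three-torus — a RUNG, NOT the Clay problem: not `d = 4`, not infinite volume,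
not a mass gap); width seat `ym-ust-19936-w4` gen 15, pen of record for (Γ5-D) (w7 g13 2026-08-29T13:00:37Z; LEAD w1 g10 S2♭″ architecture 12:29:32Z).
THEOREMS ONLY (def-free); `--supports` the K2 crux as a helper.  The companion `PoincareLipschitzSobolevSamplingL2Row.lean` proves the knit's row `hD`
(px5 g8 (Γ5-KNIT)) verbatim; this file holds its letters:
* `norm_normalize_sub_le` — distance to the sphere ≤ distance to any unit vector (`‖‖a‖⁻¹•a − a‖ ≤ ‖a − w‖`);
* `enorm_sub_sq_le_two` — `‖p − q‖ₑ² ≤ 2‖p − m‖ₑ² + 2‖m − q‖ₑ²`;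
* ★`setLIntegral_comp_floorVec_le_sum` — the `ℝ≥0∞` twin of px3's floor-cell letter `∫⁻_D G(⌊Rx⌋) ≤ (ofReal R⁻¹)³·Σ_{y∈L} G y`;
* `memLp_apply_of_integrableOn_dens` (the `dens` letter ⇒ the rows' `MemLp (GV·w) 2` letter), `lintegral_enorm_sq_le_ofReal_integral_dens`
  (`∫⁻‖GV‖ₑ² ≤ ofReal ∫ dens`, via w7's `opNorm_sq_le_dens`), `floorVec_mem_box`, `coe_sq_mul_ofReal_mul`, `cell_subset_absCube_half`
  (cells of `box 0 (⌊sR⌋+1)` lie in `Q_{(1+s)∕2}` once `(1−s)R ≥ 4`), `budget_le` (the final real arithmetic);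
* ★★`sum_good_le` — on the GOOD cells (`√(1−κ) ≤ ‖a y‖`, `v y = a y∕‖a y‖`) `Σ R⁻³‖v y − a y‖² ≤ Σ ∫_{cell_y}‖a y − V‖²`, summed over disjoint cells in
  `Q_{(1+s)∕2}` against px15 g6's (a-iv) ✓`PoincareLipschitzSobolevCellTiling.exists_lintegral_sub_cellAverage_sq_le`.
HONEST: letters; (Γ5), S2♭″, S1″, the organ `hImproveCoreFlat`∕`hHalvingBand`, K1, `MeanDeviationL`, `BlockLipschitzL`, `HistoryTailL` are NOT proved here.
[folklore] ([HardtKinderlehrerLin1986] §2; [AlicandroCicalese2008] §2; elementary measure theory).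
-/

set_option autoImplicit false

noncomputable section

open MeasureTheory Set Filter Topology TopologicalSpace
open scoped NNReal ENNReal BigOperators

namespace Summit.QuantumFields.YangMills.Theorems.PoincareLipschitzSobolevSamplingL2RowLetters

open Literature.Analysis.FunctionSpaces (HasWeakFDerivOn)
open Literature.MathematicalPhysics.QuantumFieldTheory.Balaban1983to89
open B4Eq19LatticeOperators (Zd box mem_box)
open Summit.QuantumFields.YangMills.Theorems.PoincareLipschitzSamplingCells (isOpen_absCube measurableSet_cell disjoint_cell)
open Summit.QuantumFields.YangMills.Theorems.PoincareLipschitzSobolevCellAverages (norm_smul_setIntegral_cell_le_one volume_cell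
  volume_real_cell)
open Summit.QuantumFields.YangMills.Theorems.PoincareLipschitzSobolevCellTiling (exists_lintegral_sub_cellAverage_sq_le cell_subset_unitCube
  floor_eq_of_mem_hcell)
open Summit.QuantumFields.YangMills.Theorems.PoincareLipschitzSobolevBadCellCount (card_bad_mul_le opNorm_sq_le_dens
  integral_norm_sq_eq_toReal_lintegral)
open Summit.QuantumFields.YangMills.Theorems.PoincareLipschitzBlowDownCells (measurable_comp_floorVec measurableSet_floorCell
  volume_floorCell volume_floorCell_lt_top comp_floorVec_eq_sum_indicator)
open Summit.QuantumFields.YangMills.Theorems.PoincareLipschitzLatticeToContinuumSobolevLetters (aestronglyMeasurable_of_hasWeakFDerivOn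
  integrableOn_normSq_sub_of_bound)

/-! ## §1 Letters -/

/-- **Distance to the sphere ≤ distance to any unit vector**: for `a ≠ 0` and `‖w‖ = 1`, `‖‖a‖⁻¹•a − a‖ = |1 − ‖a‖| ≤ ‖a − w‖`. [folklore] -/
theorem norm_normalize_sub_le {F : Type*} [NormedAddCommGroup F] [NormedSpace ℝ F] {a w : F} (ha : a ≠ 0) (hw : ‖w‖ = 1) :
    ‖‖a‖⁻¹ • a - a‖ ≤ ‖a - w‖ := by
  have hna : 0 < ‖a‖ := norm_pos_iff.mpr ha
  have h1 : ‖a‖⁻¹ • a - a = (‖a‖⁻¹ - 1) • a := by rw [sub_smul, one_smul]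
  rw [h1, norm_smul, Real.norm_eq_abs]
  calc |‖a‖⁻¹ - 1| * ‖a‖ = |(‖a‖⁻¹ - 1) * ‖a‖| := by rw [abs_mul, abs_of_pos hna]
    _ = |1 - ‖a‖| := by rw [sub_mul, inv_mul_cancel₀ hna.ne', one_mul]
    _ = |‖w‖ - ‖a‖| := by rw [hw]
    _ ≤ ‖w - a‖ := abs_norm_sub_norm_le w a
    _ = ‖a - w‖ := norm_sub_rev w a

/-- `‖p − q‖ₑ² ≤ 2‖p − m‖ₑ² + 2‖m − q‖ₑ²` in `ℝ≥0∞`. [folklore] -/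
theorem enorm_sub_sq_le_two {F : Type*} [NormedAddCommGroup F] (p q m : F) :
    ‖p - q‖ₑ ^ 2 ≤ 2 * ‖p - m‖ₑ ^ 2 + 2 * ‖m - q‖ₑ ^ 2 := by
  have h : ‖p - q‖ ^ 2 ≤ 2 * ‖p - m‖ ^ 2 + 2 * ‖m - q‖ ^ 2 := by
    have h0 := norm_sub_le_norm_sub_add_norm_sub p m q
    nlinarith [norm_nonneg (p - q), norm_nonneg (p - m), norm_nonneg (m - q), sq_nonneg (‖p - m‖ - ‖m - q‖)]
  have h2 : (0 : ℝ) ≤ 2 := by norm_num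
  have hpm : (0 : ℝ) ≤ 2 * ‖p - m‖ ^ 2 := by positivity
  have hmq : (0 : ℝ) ≤ 2 * ‖m - q‖ ^ 2 := by positivity
  calc ‖p - q‖ₑ ^ 2 = ENNReal.ofReal (‖p - q‖ ^ 2) := by
        rw [← ofReal_norm, ENNReal.ofReal_pow (norm_nonneg _)]
    _ ≤ ENNReal.ofReal (2 * ‖p - m‖ ^ 2 + 2 * ‖m - q‖ ^ 2) := ENNReal.ofReal_le_ofReal h
    _ = 2 * ‖p - m‖ₑ ^ 2 + 2 * ‖m - q‖ₑ ^ 2 := by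
        rw [ENNReal.ofReal_add hpm hmq, ENNReal.ofReal_mul h2, ENNReal.ofReal_mul h2, ENNReal.ofReal_ofNat,
          ENNReal.ofReal_pow (norm_nonneg _), ENNReal.ofReal_pow (norm_nonneg _), ofReal_norm, ofReal_norm]

/-- ★ **The `ℝ≥0∞` floor-cell letter**: `∫⁻_D G(⌊R x⌋) ≤ (ofReal R⁻¹)³ · Σ_{y ∈ L} G y` for `R > 0`, `D` measurable with `⌊R·D⌋ ⊆ L` (the twin of px3's
`PoincareLipschitzBlowDownCells.setIntegral_comp_floorVec_le_sum`, no integrability needed). [folklore] -/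
theorem setLIntegral_comp_floorVec_le_sum {R : ℝ} (hR : 0 < R) {D : Set (EuclideanSpace ℝ (Fin 3))} (hD : MeasurableSet D)
    (L : Finset (Zd 3)) (hL : ∀ x ∈ D, (fun i => ⌊R * x i⌋ : Zd 3) ∈ L) (G : Zd 3 → ℝ≥0∞) :
    ∫⁻ x in D, G (fun i => ⌊R * x i⌋) ≤ ENNReal.ofReal R⁻¹ ^ 3 * ∑ y ∈ L, G y := by
  classical
  calc ∫⁻ x in D, G (fun i => ⌊R * x i⌋)
      = ∫⁻ x in D, ∑ y ∈ L, Set.indicator {x' : EuclideanSpace ℝ (Fin 3) | ∀ i, ⌊R * x' i⌋ = y i} (fun _ => G y) x :=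
        setLIntegral_congr_fun hD fun x hx => comp_floorVec_eq_sum_indicator G R L (hL x hx)
    _ = ∑ y ∈ L, ∫⁻ x in D, Set.indicator {x' : EuclideanSpace ℝ (Fin 3) | ∀ i, ⌊R * x' i⌋ = y i} (fun _ => G y) x :=
        lintegral_finsetSum _ fun y _ => measurable_const.indicator (measurableSet_floorCell R y)
    _ ≤ ∑ y ∈ L, G y * ENNReal.ofReal R⁻¹ ^ 3 := by
        refine Finset.sum_le_sum fun y _ => ?_
        rw [lintegral_indicator (measurableSet_floorCell R y), setLIntegral_const]
        refine mul_le_mul_of_nonneg_left ?_ bot_le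
        rw [Measure.restrict_apply (measurableSet_floorCell R y), ← volume_floorCell hR y]
        exact measure_mono Set.inter_subset_left
    _ = ENNReal.ofReal R⁻¹ ^ 3 * ∑ y ∈ L, G y := by
        rw [Finset.mul_sum]
        exact Finset.sum_congr rfl fun y _ => mul_comm _ _

/-- **The `dens` letter gives the `MemLp` letter of the rows**: if `Σᵢ ‖GV·eᵢ‖²` is integrable on `Ω` (weak gradient of `V` there), then every
`x ↦ GV x w` is in `L²(Ω)` (`‖GV x w‖² ≤ ‖w‖²·Σᵢ‖GV x eᵢ‖²`, w7's `opNorm_sq_le_dens`). [folklore] -/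
theorem memLp_apply_of_integrableOn_dens {Ω : Opens (EuclideanSpace ℝ (Fin 3))}
    {V : EuclideanSpace ℝ (Fin 3) → EuclideanSpace ℝ (Fin 4)} {GV : EuclideanSpace ℝ (Fin 3) → (EuclideanSpace ℝ (Fin 3) →L[ℝ] EuclideanSpace ℝ (Fin 4))}
    (hV : HasWeakFDerivOn Ω volume V GV)
    (hdens : IntegrableOn (fun x => ∑ i : Fin 3, ‖GV x (EuclideanSpace.single i (1:ℝ))‖ ^ 2) (Ω : Set _) volume)
    (w : EuclideanSpace ℝ (Fin 3)) : MemLp (fun x => GV x w) 2 (volume.restrict (Ω : Set _)) := by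
  have hGm : AEStronglyMeasurable GV (volume.restrict (Ω : Set _)) := hV.locallyIntegrableOn_deriv.aestronglyMeasurable
  have hm : AEStronglyMeasurable (fun x => GV x w) (volume.restrict (Ω : Set _)) := hGm.apply_continuousLinearMap w
  rw [memLp_two_iff_integrable_sq_norm hm]
  have hm2 : AEStronglyMeasurable (fun x => ‖GV x w‖ ^ 2) (volume.restrict (Ω : Set _)) := hm.norm.pow 2
  refine Integrable.mono' (hdens.const_mul (‖w‖ ^ 2)) hm2 (Filter.Eventually.of_forall fun x => ?_)
  rw [Real.norm_of_nonneg (by positivity)]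
  have h1 : ‖GV x w‖ ≤ ‖GV x‖ * ‖w‖ := (GV x).le_opNorm w
  have h2 := opNorm_sq_le_dens (GV x)
  have h3 : ‖GV x w‖ ^ 2 ≤ (‖GV x‖ * ‖w‖) ^ 2 := pow_le_pow_left₀ (norm_nonneg _) h1 2
  calc ‖GV x w‖ ^ 2 ≤ ‖w‖ ^ 2 * ‖GV x‖ ^ 2 := by rw [mul_pow] at h3; linarith
    _ ≤ ‖w‖ ^ 2 * ∑ i : Fin 3, ‖GV x (EuclideanSpace.single i (1:ℝ))‖ ^ 2 :=
        mul_le_mul_of_nonneg_left h2 (sq_nonneg _)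

/-- `∫⁻_A ‖GV‖ₑ² ≤ ofReal ∫_A Σᵢ‖GV·eᵢ‖²` when the density is integrable on `A`. [folklore] -/
theorem lintegral_enorm_sq_le_ofReal_integral_dens {A : Set (EuclideanSpace ℝ (Fin 3))}
    {GV : EuclideanSpace ℝ (Fin 3) → (EuclideanSpace ℝ (Fin 3) →L[ℝ] EuclideanSpace ℝ (Fin 4))}
    (hdens : IntegrableOn (fun x => ∑ i : Fin 3, ‖GV x (EuclideanSpace.single i (1:ℝ))‖ ^ 2) A volume) :
    ∫⁻ x in A, ‖GV x‖ₑ ^ 2 ≤ ENNReal.ofReal (∫ x in A, ∑ i : Fin 3, ‖GV x (EuclideanSpace.single i (1:ℝ))‖ ^ 2) := by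
  rw [ofReal_integral_eq_lintegral_ofReal hdens
    (Filter.Eventually.of_forall fun x => Finset.sum_nonneg fun i _ => by positivity)]
  refine lintegral_mono fun x => ?_
  rw [← ofReal_norm, ← ENNReal.ofReal_pow (norm_nonneg _)]
  exact ENNReal.ofReal_le_ofReal (opNorm_sq_le_dens (GV x))

/-- The floor labels of the points of `Q_s` lie in `box 0 (⌊sR⌋ + 1)`. [folklore] -/
theorem floorVec_mem_box {R : ℕ} {s : ℝ} {x : EuclideanSpace ℝ (Fin 3)} (hx : ∀ i : Fin 3, |x i| < s) :
    (fun i => ⌊(R : ℝ) * x i⌋ : Zd 3) ∈ box (0 : Zd 3) (⌊s * R⌋ + 1) := by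
  rw [mem_box]
  intro i
  have hR : (0 : ℝ) ≤ R := Nat.cast_nonneg R
  have h := abs_lt.1 (hx i)
  have hup : (R : ℝ) * x i ≤ s * R := by nlinarith [h.2]
  have hlo : -(s * R) ≤ (R : ℝ) * x i := by nlinarith [h.1]
  have h1 : ⌊(R : ℝ) * x i⌋ ≤ ⌊s * (R : ℝ)⌋ := Int.floor_mono hup
  have h2 : -(⌊s * (R : ℝ)⌋ + 1) ≤ ⌊(R : ℝ) * x i⌋ := by
    have h3 := Int.lt_floor_add_one (s * (R : ℝ))
    exact Int.le_floor.2 (by push_cast; linarith)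
  simp only [Pi.zero_apply, sub_zero]
  exact abs_le.2 ⟨by linarith, by linarith⟩

/-- `(C:ℝ≥0∞)² · ofReal x · ofReal y = ofReal (C²·x·y)` for `x ≥ 0`. [folklore] -/
theorem coe_sq_mul_ofReal_mul (C : ℝ≥0) {x : ℝ} (y : ℝ) (hx : 0 ≤ x) :
    (C : ℝ≥0∞) ^ 2 * ENNReal.ofReal x * ENNReal.ofReal y = ENNReal.ofReal ((C : ℝ) ^ 2 * x * y) := by
  have hC0 : 0 ≤ (C : ℝ) ^ 2 := by positivity
  have hCx : 0 ≤ (C : ℝ) ^ 2 * x := mul_nonneg hC0 hx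
  rw [ENNReal.ofReal_mul hCx, ENNReal.ofReal_mul hC0, ENNReal.ofReal_pow C.coe_nonneg, ENNReal.ofReal_coe_nnreal]

/-- The cells of `box 0 (⌊sR⌋+1)` lie in `Q_{(1+s)∕2}` once `(1 − s)R ≥ 4`. [folklore] -/
theorem cell_subset_absCube_half {R : ℕ} (hR : 0 < R) {s : ℝ} (hsR : 4 ≤ (1 - s) * R) {y : Zd 3}
    (hy : y ∈ box (0 : Zd 3) (⌊s * (R : ℝ)⌋ + 1)) :
    {x : EuclideanSpace ℝ (Fin 3) | ∀ i, (y i : ℝ) / R < x i ∧ x i < ((y i : ℝ) + 1) / R} ⊆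
      {x : EuclideanSpace ℝ (Fin 3) | ∀ i : Fin 3, |x i| < (1 + s) / 2} := by
  intro x hx i
  have hR0 : (0 : ℝ) < R := by exact_mod_cast hR
  rw [mem_box] at hy
  have hyi := abs_le.1 (hy i)
  have hz : (0 : Zd 3) i = 0 := rfl
  rw [hz, sub_zero] at hyi
  have hyi1 : (y i : ℝ) ≤ ⌊s * (R : ℝ)⌋ + 1 := by exact_mod_cast hyi.2
  have hyi2 : -((⌊s * (R : ℝ)⌋ : ℝ) + 1) ≤ (y i : ℝ) := by
    have h := hyi.1
    have h' : -(⌊s * (R : ℝ)⌋ + 1) ≤ y i := h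
    exact_mod_cast h'
  have hfl := Int.floor_le (s * (R : ℝ))
  have hNR : ((⌊s * (R : ℝ)⌋ : ℤ) : ℝ) + 2 ≤ (1 + s) / 2 * R := by linarith
  have hx1 := (hx i).1
  have hx2 := (hx i).2
  rw [div_lt_iff₀ hR0] at hx1
  rw [lt_div_iff₀ hR0] at hx2
  rw [abs_lt]
  constructor
  · by_contra hc
    push Not at hc
    have : x i * R ≤ -((1 + s) / 2) * R := mul_le_mul_of_nonneg_right hc hR0.le
    linarith
  · by_contra hc
    push Not at hc
    have : (1 + s) / 2 * R ≤ x i * R := mul_le_mul_of_nonneg_right hc hR0.le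
    linarith

/-- The arithmetic of the budget: with `κ·nb ≤ C_b²·R·I`, `K := 4C_a²I + 8C_b²I∕κ`, `K∕ε ≤ R`, `R ≥ 1`, the three contributions sum to `≤ ε`. [folklore] -/
theorem budget_le {CA CB I κ ε R nb : ℝ} (hκ : 0 < κ) (hε : 0 < ε) (hI : 0 ≤ I) (hR1 : 1 ≤ R)
    (hbad : κ * nb ≤ CB ^ 2 * R * I) (hRK : (4 * CA ^ 2 * I + 8 * CB ^ 2 * I / κ) / ε ≤ R) :
    2 * (CA ^ 2 * (R⁻¹) ^ 2 * I + 4 * (R⁻¹) ^ 3 * nb) + 2 * (CA ^ 2 * (R⁻¹) ^ 2 * I) ≤ ε := by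
  have hR0 : 0 < R := by linarith
  have hRi0 : 0 ≤ R⁻¹ := by positivity
  have hRi1 : R⁻¹ ≤ 1 := inv_le_one_of_one_le₀ hR1
  have hK0 : 0 ≤ 4 * CA ^ 2 * I + 8 * CB ^ 2 * I / κ := by positivity
  -- `R⁻³ nb ≤ (CB² I ∕ κ) R⁻²`
  have h1 : nb ≤ CB ^ 2 * R * I / κ := by rw [le_div_iff₀ hκ]; linarith
  have h2 : (R⁻¹) ^ 3 * nb ≤ (R⁻¹) ^ 3 * (CB ^ 2 * R * I / κ) := mul_le_mul_of_nonneg_left h1 (by positivity)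
  have h3 : (R⁻¹) ^ 3 * (CB ^ 2 * R * I / κ) = CB ^ 2 * I / κ * (R⁻¹) ^ 2 := by
    have e : (R⁻¹) ^ 3 * R = (R⁻¹) ^ 2 := by
      rw [pow_succ, mul_assoc, inv_mul_cancel₀ hR0.ne', mul_one]
    calc (R⁻¹) ^ 3 * (CB ^ 2 * R * I / κ) = (R⁻¹) ^ 3 * R * (CB ^ 2 * I / κ) := by ring
      _ = CB ^ 2 * I / κ * (R⁻¹) ^ 2 := by rw [e]; ring
  -- `K R⁻² ≤ K R⁻¹ ≤ ε`
  have h4 : 4 * CA ^ 2 * I + 8 * CB ^ 2 * I / κ ≤ ε * R := by rw [div_le_iff₀ hε] at hRK; linarith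
  have h5 : (4 * CA ^ 2 * I + 8 * CB ^ 2 * I / κ) * (R⁻¹) ^ 2 ≤ ε * R * (R⁻¹) ^ 2 :=
    mul_le_mul_of_nonneg_right h4 (by positivity)
  have h6 : ε * R * (R⁻¹) ^ 2 = ε * R⁻¹ := by
    rw [pow_two, ← mul_assoc, mul_assoc ε, mul_inv_cancel₀ hR0.ne', mul_one]
  have h7 : ε * R⁻¹ ≤ ε * 1 := mul_le_mul_of_nonneg_left hRi1 hε.le
  have h8 : 2 * (CA ^ 2 * (R⁻¹) ^ 2 * I + 4 * (R⁻¹) ^ 3 * nb) + 2 * (CA ^ 2 * (R⁻¹) ^ 2 * I) ≤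
      (4 * CA ^ 2 * I + 8 * CB ^ 2 * I / κ) * (R⁻¹) ^ 2 := by
    have h23 : (R⁻¹) ^ 3 * nb ≤ CB ^ 2 * I / κ * (R⁻¹) ^ 2 := h2.trans (le_of_eq h3)
    have e1 : 2 * (CA ^ 2 * (R⁻¹) ^ 2 * I + 4 * (R⁻¹) ^ 3 * nb) + 2 * (CA ^ 2 * (R⁻¹) ^ 2 * I) =
        4 * (CA ^ 2 * (R⁻¹) ^ 2 * I) + 8 * ((R⁻¹) ^ 3 * nb) := by ring
    have e2 : (4 * CA ^ 2 * I + 8 * CB ^ 2 * I / κ) * (R⁻¹) ^ 2 =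
        4 * (CA ^ 2 * (R⁻¹) ^ 2 * I) + 8 * (CB ^ 2 * I / κ * (R⁻¹) ^ 2) := by ring
    rw [e1, e2]
    linarith
  linarith

/-- **The good cells' contribution.**  On the cells of `box 0 (⌊sR⌋+1)` (all inside `Q`, and inside `Q_{(1+s)∕2}` once `(1−s)R ≥ 4`) where
`√(1−κ) ≤ ‖a y‖` and `v y = a y∕‖a y‖`: `Σ_good R⁻³‖v y − a y‖² ≤ Σ_good ∫_{cell_y}‖a y − V‖²`, which (a-iv) at `(1+s)∕2` bounds. [folklore] -/
theorem sum_good_le {V : EuclideanSpace ℝ (Fin 3) → EuclideanSpace ℝ (Fin 4)} {a v : Zd 3 → EuclideanSpace ℝ (Fin 4)}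
    {R : ℕ} {s κ B : ℝ} (hRpos : 0 < R) (hsR4 : 4 ≤ (1 - s) * R) (hN1 : ⌊s * (R : ℝ)⌋ + 1 + 1 ≤ (R : ℤ)) (hκ1 : κ < 1)
    (hV1 : ∀ x : EuclideanSpace ℝ (Fin 3), (∀ i : Fin 3, |x i| < 1) → ‖V x‖ = 1)
    (hVm : AEStronglyMeasurable V (volume.restrict {x : EuclideanSpace ℝ (Fin 3) | ∀ i : Fin 3, |x i| < 1}))
    (ha1 : ∀ y ∈ box (0 : Zd 3) (⌊s * (R : ℝ)⌋ + 1), ‖a y‖ ≤ 1)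
    (hvg : ∀ y, Real.sqrt (1 - κ) ≤ ‖a y‖ → v y = ‖a y‖⁻¹ • a y) (hB : 0 ≤ B)
    (hA'' : ∫⁻ x in {x : EuclideanSpace ℝ (Fin 3) | ∀ i : Fin 3, |x i| < (1 + s) / 2},
      ‖a (fun i => ⌊(R : ℝ) * x i⌋) - V x‖ₑ ^ 2 ≤ ENNReal.ofReal B) :
    ∑ y ∈ (box (0 : Zd 3) (⌊s * (R : ℝ)⌋ + 1)).filter (fun y => Real.sqrt (1 - κ) ≤ ‖a y‖),
      ((R : ℝ)⁻¹) ^ 3 * ‖v y - a y‖ ^ 2 ≤ B := by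
  have hcellQ : ∀ y ∈ box (0 : Zd 3) (⌊s * (R : ℝ)⌋ + 1),
      {x : EuclideanSpace ℝ (Fin 3) | ∀ i, (y i : ℝ) / R < x i ∧ x i < ((y i : ℝ) + 1) / R} ⊆
        {x : EuclideanSpace ℝ (Fin 3) | ∀ i : Fin 3, |x i| < 1} :=
    fun y hy => cell_subset_unitCube hRpos hN1 hy
  -- integrability of `‖a y − V‖²` on a cell of the family
  have hint_cell : ∀ y ∈ box (0 : Zd 3) (⌊s * (R : ℝ)⌋ + 1), IntegrableOn (fun x => ‖a y - V x‖ ^ 2)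
      {x : EuclideanSpace ℝ (Fin 3) | ∀ i, (y i : ℝ) / R < x i ∧ x i < ((y i : ℝ) + 1) / R} volume := by
    intro y hyY
    have hfin : volume {x : EuclideanSpace ℝ (Fin 3) | ∀ i, (y i : ℝ) / R < x i ∧ x i < ((y i : ℝ) + 1) / R} ≠ ⊤ := by
      rw [volume_cell hRpos y]; exact ENNReal.ofReal_ne_top
    exact integrableOn_normSq_sub_of_bound hfin.lt_top aestronglyMeasurable_const
      (hVm.mono_measure (Measure.restrict_mono (hcellQ y hyY) le_rfl)) (fun _ => ha1 y hyY)
      ((ae_restrict_iff' (measurableSet_cell R y)).mpr (ae_of_all _ fun x hx => (hV1 x (hcellQ y hyY hx)).le))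
  -- GOOD cells: `R⁻³‖v y − a y‖² ≤ ∫_{cell_y} ‖a y − V‖²`
  have hgood : ∀ y ∈ (box (0 : Zd 3) (⌊s * (R : ℝ)⌋ + 1)).filter (fun y => Real.sqrt (1 - κ) ≤ ‖a y‖),
      ((R : ℝ)⁻¹) ^ 3 * ‖v y - a y‖ ^ 2 ≤
        ∫ x in {x : EuclideanSpace ℝ (Fin 3) | ∀ i, (y i : ℝ) / R < x i ∧ x i < ((y i : ℝ) + 1) / R}, ‖a y - V x‖ ^ 2 := by
    intro y hy
    obtain ⟨hyY, hgy⟩ := Finset.mem_filter.1 hy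
    have hsq : 0 < Real.sqrt (1 - κ) := Real.sqrt_pos.2 (by linarith)
    have hay0 : a y ≠ 0 := by
      intro h
      rw [h, norm_zero] at hgy
      linarith
    have hptw : ∀ x ∈ {x : EuclideanSpace ℝ (Fin 3) | ∀ i, (y i : ℝ) / R < x i ∧ x i < ((y i : ℝ) + 1) / R},
        (fun _ : EuclideanSpace ℝ (Fin 3) => ‖v y - a y‖ ^ 2) x ≤ ‖a y - V x‖ ^ 2 := by
      intro x hx
      have h1 : ‖v y - a y‖ ≤ ‖a y - V x‖ := by
        rw [hvg y hgy]
        exact norm_normalize_sub_le hay0 (hV1 x (hcellQ y hyY hx))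
      exact pow_le_pow_left₀ (norm_nonneg _) h1 2
    have hfin : volume {x : EuclideanSpace ℝ (Fin 3) | ∀ i, (y i : ℝ) / R < x i ∧ x i < ((y i : ℝ) + 1) / R} ≠ ⊤ := by
      rw [volume_cell hRpos y]; exact ENNReal.ofReal_ne_top
    have hconst : ∫ x in {x : EuclideanSpace ℝ (Fin 3) | ∀ i, (y i : ℝ) / R < x i ∧ x i < ((y i : ℝ) + 1) / R},
        (fun _ : EuclideanSpace ℝ (Fin 3) => ‖v y - a y‖ ^ 2) x = ((R : ℝ)⁻¹) ^ 3 * ‖v y - a y‖ ^ 2 := by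
      rw [setIntegral_const, volume_real_cell hRpos y, smul_eq_mul]
    rw [← hconst]
    exact setIntegral_mono_on (integrableOn_const hfin) (hint_cell y hyY) (measurableSet_cell R y) hptw
  -- the sum of the good cell integrals, through (a-iv) at `(1+s)/2`
  have hle1 : ∑ y ∈ (box (0 : Zd 3) (⌊s * (R : ℝ)⌋ + 1)).filter (fun y => Real.sqrt (1 - κ) ≤ ‖a y‖),
      ∫ x in {x : EuclideanSpace ℝ (Fin 3) | ∀ i, (y i : ℝ) / R < x i ∧ x i < ((y i : ℝ) + 1) / R}, ‖a y - V x‖ ^ 2 ≤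
      ∑ y ∈ box (0 : Zd 3) (⌊s * (R : ℝ)⌋ + 1),
      ∫ x in {x : EuclideanSpace ℝ (Fin 3) | ∀ i, (y i : ℝ) / R < x i ∧ x i < ((y i : ℝ) + 1) / R}, ‖a y - V x‖ ^ 2 :=
    Finset.sum_le_sum_of_subset_of_nonneg (Finset.filter_subset _ _)
      fun y _ _ => integral_nonneg fun x => by positivity
  have hle2 : ∀ y ∈ box (0 : Zd 3) (⌊s * (R : ℝ)⌋ + 1),
      ENNReal.ofReal (∫ x in {x : EuclideanSpace ℝ (Fin 3) | ∀ i, (y i : ℝ) / R < x i ∧ x i < ((y i : ℝ) + 1) / R},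
        ‖a y - V x‖ ^ 2) =
      ∫⁻ x in {x : EuclideanSpace ℝ (Fin 3) | ∀ i, (y i : ℝ) / R < x i ∧ x i < ((y i : ℝ) + 1) / R},
        ‖a (fun i => ⌊(R : ℝ) * x i⌋) - V x‖ₑ ^ 2 := by
    intro y hy
    rw [ofReal_integral_eq_lintegral_ofReal (hint_cell y hy) (Filter.Eventually.of_forall fun x => by positivity)]
    refine setLIntegral_congr_fun (measurableSet_cell R y) fun x hx => ?_
    rw [floor_eq_of_mem_hcell hRpos (fun i => ⟨(hx i).1.le, (hx i).2⟩), ← ofReal_norm,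
      ENNReal.ofReal_pow (norm_nonneg _)]
  have hle3 : ∑ y ∈ box (0 : Zd 3) (⌊s * (R : ℝ)⌋ + 1),
      ∫⁻ x in {x : EuclideanSpace ℝ (Fin 3) | ∀ i, (y i : ℝ) / R < x i ∧ x i < ((y i : ℝ) + 1) / R},
        ‖a (fun i => ⌊(R : ℝ) * x i⌋) - V x‖ₑ ^ 2 ≤
      ∫⁻ x in {x : EuclideanSpace ℝ (Fin 3) | ∀ i : Fin 3, |x i| < (1 + s) / 2},
        ‖a (fun i => ⌊(R : ℝ) * x i⌋) - V x‖ₑ ^ 2 := by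
    rw [← lintegral_biUnion_finset (fun y _ y' _ hne => disjoint_cell hRpos hne) (fun y _ => measurableSet_cell R y)]
    exact lintegral_mono_set (Set.iUnion₂_subset fun y hy => cell_subset_absCube_half hRpos hsR4 hy)
  have hfinal : ENNReal.ofReal (∑ y ∈ box (0 : Zd 3) (⌊s * (R : ℝ)⌋ + 1),
      ∫ x in {x : EuclideanSpace ℝ (Fin 3) | ∀ i, (y i : ℝ) / R < x i ∧ x i < ((y i : ℝ) + 1) / R}, ‖a y - V x‖ ^ 2) ≤
      ENNReal.ofReal B := by
    rw [ENNReal.ofReal_sum_of_nonneg (fun y _ => integral_nonneg fun x => by positivity), Finset.sum_congr rfl hle2]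
    exact hle3.trans hA''
  exact ((Finset.sum_le_sum hgood).trans hle1).trans ((ENNReal.ofReal_le_ofReal_iff hB).1 hfinal)

end Summit.QuantumFields.YangMills.Theorems.PoincareLipschitzSobolevSamplingL2RowLetters

end
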